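import Mathlib
import Summits.Parity.BatemanHorn.Theses.PolynomialMobius
import Summits.Parity.BatemanHorn.Theorems.PolynomialMobiusPolyMobiusTailStubPairSwapCount
import Literature.NumberTheory.Sieve.LinearPairMoebiusWindow
import HarnessLib

/-!
# Crux `PolyMobiusTail` (stmt-Parity-0870), line `eta-free-multilinear-window`:
# stub `stub_pair_balanced` (S1b-P3, the Duke–Friedlander–Iwaniec range of the linear pair window)

Lead `prover-line-stmt-Parity-0870-c3-0`, stub-workers W3/W3b.  For a Bateman–Horn PAIR
`f = (q₀X + a₀, q₁X + a₁)` of degree `≤ 1` and `5/11 < σ < 1/2` there is `c = c(f, σ) > 0` such that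
for all `0 < θ, η ≤ c` the balanced part of the divisor window,

  `Σ_{n ≤ x} Σ_{dᵢ ∣ fᵢ(n)} [x^{1−η} < d₀d₁ ≤ x^{1+θ}] [min dᵢ > x^σ] μ(d₀) log d₀ μ(d₁) log d₁ = o(x)`.

Assembly (everything substantive is in the Literature library):

1. swap the summations (`stub_pairSwapCount`): `Σ_{d ∈ Box(x)} G_x(d) · A(d; x)` with the count
   `A(d; x) = #{n₀ < n ≤ x : d₀ ∣ q₀n + a₀, d₁ ∣ q₁n + a₁}`, `Box(x) = [1, f₀(x)⁺] × [1, f₁(x)⁺]`;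
2. read the box as a double sum (`LinearPairMoebius.sum_piFinset_two`) and the pair data
   `qᵢ = leadingCoeff`, `aᵢ = coeff 0` (`PairLinear.*`: `gcd(qᵢ,aᵢ) = 1`, `Δ = q₁a₀ − q₀a₁ ≠ 0`);
3. apply `LinearPairMoebius.window_pair_sum_isLittleO` (Literature; main term `≪ x/log x` by
   Siegel–Walfisz, sawtooth sums by Erdős–Turán + the Duke–Friedlander–Iwaniec bilinear
   Kloosterman-fraction bound, saving `x^{(11σ−5)/48}`), the box sides `fᵢ(x)⁺ = qᵢx + aᵢ`
   satisfying `x^{1−σ/2} ≤ fᵢ(x)⁺ ≤ x²` eventually (`box_side_eventually`).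

STATUS / provenance (all ACCEPTED, authored under the lead's identity): p139214 `…StubPairSwapCount`
(aux stub `stub_pairSwapCount`), p142105 `…StubPairBalancedMainTerm` (aux stub
`stub_pairMainTermTendsto`, not needed by this assembly), and the Literature chain p138644
`WeightedSawtoothSums`, p138942 `LinearCongruencePairs`, p139667 `MoebiusCoprimeTailSums`, p141653
`LinearPairMoebiusMainTerm`, p142548 `LinearPairKloostermanPiece`, p143713 `LinearPairKloostermanBox`,
p144207 `LinearPairKloostermanExpSum`, p143840 `LinearPairMoebiusWindowDecomp`, then
`LinearPairMoebiusWindow` (`window_pair_sum_isLittleO`) and this file.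
-/

open scoped BigOperators ArithmeticFunction.Moebius
open Filter Finset Polynomial Asymptotics

namespace Summit.Parity.BatemanHorn.Theorems.PolyMobiusTail.EtaFreeWindow

open Literature.NumberTheory.Sieve Literature.NumberTheory.Sieve.LinearCongruencePair

namespace PairBalanced

/-- The box sides `(q x + a)⁺` satisfy `x^{1−σ/2} ≤ (qx + a)⁺ ≤ x²` eventually (`q ≥ 1`, `σ > 0`).
[folklore] -/
theorem box_side_eventually {q : ℕ} (hq : 0 < q) (a : ℤ) {σ : ℝ} (hσ : 0 < σ) :
    ∀ᶠ x : ℕ in atTop, (x : ℝ) ^ (1 - σ / 2) ≤ ((((q : ℤ) * x + a).toNat : ℕ) : ℝ) ∧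
      ((((q : ℤ) * x + a).toNat : ℕ) : ℝ) ≤ (x : ℝ) ^ 2 := by
  have hev₁ : ∀ᶠ x : ℕ in atTop, (2 : ℝ) ≤ (x : ℝ) ^ (σ / 2) :=
    ((tendsto_rpow_atTop (by linarith)).comp tendsto_natCast_atTop_atTop).eventually_ge_atTop _
  have hev₂ : ∀ᶠ x : ℕ in atTop, 2 * a.natAbs + q ≤ x := eventually_ge_atTop _
  have hev₃ : ∀ᶠ x : ℕ in atTop, 1 ≤ x := eventually_ge_atTop 1
  filter_upwards [hev₁, hev₂, hev₃] with x hx₁ hx₂ hx₃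
  have hx0 : (0 : ℝ) < x := by exact_mod_cast hx₃
  have hq1 : (1 : ℝ) ≤ q := by exact_mod_cast hq
  have hx₂R : 2 * (a.natAbs : ℝ) + q ≤ x := by exact_mod_cast hx₂
  have haR : |(a : ℝ)| = (a.natAbs : ℝ) := by
    rw [← Int.cast_abs, Nat.cast_natAbs]
  have ha1 : -(a.natAbs : ℝ) ≤ (a : ℝ) := by rw [← haR]; exact neg_abs_le _
  have ha2 : (a : ℝ) ≤ (a.natAbs : ℝ) := by rw [← haR]; exact le_abs_self _
  -- lower bound for the integer value
  have hlow : (q : ℝ) * x + a ≤ ((((q : ℤ) * x + a).toNat : ℕ) : ℝ) := by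
    have : ((q : ℤ) * x + a : ℤ) ≤ ((((q : ℤ) * x + a).toNat : ℕ) : ℤ) := Int.self_le_toNat _
    exact_mod_cast this
  constructor
  · -- `x^{1−σ/2} ≤ x/2 ≤ x − |a| ≤ qx + a`
    have h1 : (x : ℝ) = (x : ℝ) ^ (1 - σ / 2) * (x : ℝ) ^ (σ / 2) := by
      rw [← Real.rpow_add hx0]; ring_nf; rw [Real.rpow_one]
    have h2 : 2 * (x : ℝ) ^ (1 - σ / 2) ≤ x := by
      have h0 : 0 ≤ (x : ℝ) ^ (1 - σ / 2) := by positivity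
      calc 2 * (x : ℝ) ^ (1 - σ / 2) = (x : ℝ) ^ (1 - σ / 2) * 2 := by ring
        _ ≤ (x : ℝ) ^ (1 - σ / 2) * (x : ℝ) ^ (σ / 2) := mul_le_mul_of_nonneg_left hx₁ h0
        _ = x := h1.symm
    have h3 : (x : ℝ) ≤ (q : ℝ) * x := by nlinarith
    linarith
  · -- `qx + a ≤ (q + |a|) x ≤ x²`
    rcases le_or_gt 0 ((q : ℤ) * x + a) with h | h
    · have : ((((q : ℤ) * x + a).toNat : ℕ) : ℤ) = (q : ℤ) * x + a := Int.toNat_of_nonneg h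
      have hR : ((((q : ℤ) * x + a).toNat : ℕ) : ℝ) = (q : ℝ) * x + a := by exact_mod_cast this
      rw [hR]
      have hx1 : (1 : ℝ) ≤ x := by exact_mod_cast hx₃
      nlinarith
    · rw [Int.toNat_eq_zero.2 h.le]; push_cast; positivity

end PairBalanced

open PairLinear PairBalanced in
/-- **S1b-P3 · BALANCED part of the linear pair window (the Duke–Friedlander–Iwaniec range).**
For a Bateman–Horn pair of degree `≤ 1` and `5/11 < σ < 1/2` there is `c > 0` such that for all
`0 < θ, η ≤ c`,
`Σ_{n ≤ x} Σ_{dᵢ ∣ fᵢ(n)} [x^{1−η} < d₀d₁ ≤ x^{1+θ}] [x^σ < min dᵢ] μ(d₀)log d₀ μ(d₁)log d₁ = o(x)`: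
swap of summations (`stub_pairSwapCount`), the pair data (`PairLinear.*`) and
`LinearPairMoebius.window_pair_sum_isLittleO`. [folklore] -/
theorem stub_pair_balanced : ∀ (f : Fin 2 → ℤ[X]), IsBatemanHornSystem f → (∀ i, (f i).natDegree ≤ 1) →
    ∀ σ : ℝ, 5 / 11 < σ → σ < 1 / 2 →
    ∃ c : ℝ, 0 < c ∧ ∀ θ η : ℝ, 0 < θ → θ ≤ c → 0 < η → η ≤ c →
      (fun x : ℕ => ∑ n ∈ Finset.Icc 1 x,
        ∑ d ∈ Fintype.piFinset (fun i => (((f i).eval (n : ℤ)).toNat).divisors),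
          if (x : ℝ) ^ (1 - η) < ∏ i, (d i : ℝ) ∧ ∏ i, (d i : ℝ) ≤ (x : ℝ) ^ (1 + θ) ∧
              (x : ℝ) ^ σ < ((min (d 0) (d 1) : ℕ) : ℝ) then
            ∏ i, ((ArithmeticFunction.moebius (d i) : ℝ) * Real.log (d i)) else 0)
        =o[atTop] fun x : ℕ => (x : ℝ) := by
  intro f hf hlin σ hσ hσ'
  have hdeg : ∀ i, (f i).natDegree = 1 := natDegree_eq_one hf hlin
  -- the data of the pair
  set q₀ : ℕ := (f 0).leadingCoeff.toNat with hq₀def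
  set q₁ : ℕ := (f 1).leadingCoeff.toNat with hq₁def
  set a₀ : ℤ := (f 0).coeff 0 with ha₀def
  set a₁ : ℤ := (f 1).coeff 0 with ha₁def
  obtain ⟨hq₀pos, hq₀Z⟩ := leadingCoeff_toNat hf 0
  obtain ⟨hq₁pos, hq₁Z⟩ := leadingCoeff_toNat hf 1
  have hc₀ : IsCoprime (q₀ : ℤ) a₀ := by
    rw [hq₀Z]; exact isCoprime_leadingCoeff_coeff_zero hf (hdeg 0)
  have hc₁ : IsCoprime (q₁ : ℤ) a₁ := by
    rw [hq₁Z]; exact isCoprime_leadingCoeff_coeff_zero hf (hdeg 1)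
  have hΔ : (q₁ : ℤ) * a₀ - (q₀ : ℤ) * a₁ ≠ 0 := by
    rw [hq₀Z, hq₁Z]; exact resultant_ne_zero hf hdeg
  have heval : ∀ (i : Fin 2) (n : ℤ), (f i).eval n = (f i).leadingCoeff * n + (f i).coeff 0 :=
    fun i n => eval_eq (hdeg i) n
  -- the Literature theorem
  obtain ⟨c, hc, hmain⟩ := LinearPairMoebius.window_pair_sum_isLittleO hq₀pos hq₁pos hc₀ hc₁ hΔ hσ hσ'
  refine ⟨c, hc, fun θ η hθ hθc hη hηc => ?_⟩
  set n₀ : ℕ := max ((-(f 0).coeff 0).toNat / (f 0).leadingCoeff.toNat)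
    ((-(f 1).coeff 0).toNat / (f 1).leadingCoeff.toNat) with hn₀
  have hσ0 : 0 < σ := by linarith
  have hB : ∀ᶠ x : ℕ in atTop,
      (x : ℝ) ^ (1 - σ / 2) ≤ ((((f 0).eval (x : ℤ)).toNat : ℕ) : ℝ) ∧
        ((((f 0).eval (x : ℤ)).toNat : ℕ) : ℝ) ≤ (x : ℝ) ^ 2 ∧
      (x : ℝ) ^ (1 - σ / 2) ≤ ((((f 1).eval (x : ℤ)).toNat : ℕ) : ℝ) ∧
        ((((f 1).eval (x : ℤ)).toNat : ℕ) : ℝ) ≤ (x : ℝ) ^ 2 := by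
    filter_upwards [box_side_eventually hq₀pos a₀ hσ0, box_side_eventually hq₁pos a₁ hσ0]
      with x h0 h1
    rw [heval 0, heval 1, ← hq₀Z, ← hq₁Z]
    exact ⟨h0.1, h0.2, h1.1, h1.2⟩
  have h := hmain θ η hθ hθc hη hηc n₀ (fun x => ((f 0).eval (x : ℤ)).toNat)
    (fun x => ((f 1).eval (x : ℤ)).toNat) hB
  refine h.congr' (Eventually.of_forall fun x => ?_) EventuallyEq.rfl
  -- identify the two functions at every `x`
  beta_reduce
  symm
  rw [stub_pairSwapCount f hf hlin _ x, LinearPairMoebius.sum_piFinset_two]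
  refine Finset.sum_congr rfl fun d₀ _ => Finset.sum_congr rfl fun d₁ _ => ?_
  simp only [Fin.prod_univ_two, Matrix.cons_val_zero, Matrix.cons_val_one, Nat.cast_min]
  -- the window weight
  have hG : (if ((x : ℝ) ^ (1 - η) < (d₀ : ℝ) * d₁ ∧ (d₀ : ℝ) * d₁ ≤ (x : ℝ) ^ (1 + θ) ∧
        (x : ℝ) ^ σ < min (d₀ : ℝ) (d₁ : ℝ)) then
        (μ d₀ : ℝ) * Real.log d₀ * ((μ d₁ : ℝ) * Real.log d₁) else 0) =
      (if ((x : ℝ) ^ (1 - η) < (d₀ : ℝ) * d₁ ∧ (d₀ : ℝ) * d₁ ≤ (x : ℝ) ^ (1 + θ) ∧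
          (x : ℝ) ^ σ < (d₀ : ℝ) ∧ (x : ℝ) ^ σ < (d₁ : ℝ)) then
        (μ d₀ : ℝ) * Real.log d₀ * ((μ d₁ : ℝ) * Real.log d₁) else 0) := by
    simp only [lt_min_iff]
  -- the count
  have hset : (Finset.Ioc n₀ x).filter (fun n : ℕ => ∀ i, ((![d₀, d₁] i : ℕ) : ℤ) ∣ (f i).eval (n : ℤ)) =
      (Finset.Ioc n₀ x).filter (fun n : ℕ =>
        (d₀ : ℤ) ∣ (q₀ : ℤ) * n + a₀ ∧ (d₁ : ℤ) ∣ (q₁ : ℤ) * n + a₁) := by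
    refine Finset.filter_congr fun n _ => ?_
    simp only [Fin.forall_fin_two, Matrix.cons_val_zero, Matrix.cons_val_one]
    rw [heval 0, heval 1, hq₀Z, hq₁Z]
  rw [hG, hset]

end Summit.Parity.BatemanHorn.Theorems.PolyMobiusTail.EtaFreeWindow
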